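import Summits.BirchSwinnertonDyer.BirchSwinnertonDyer.Theorems.GenusKolyvaginAtTwoOffCutResidualAtTwoRLw2TateWitness
import Summits.BirchSwinnertonDyer.BirchSwinnertonDyer.Theorems.GenusKolyvaginAtTwoOffCutResidualAtTwoRLw2PhantomExclusionRat
import HarnessLib

/-!
# Route `GenusKolyvaginAtTwo`, kernel items `K4Pos` (stmt-BirchSwinnertonDyer-31469) / `K4Neg` (stmt-31526), LINES 33/34 «twin_bsd_road»,
# stub F4″ `stub_offCutNonPhantomAtTwo`: THE `2`-MULTIPLICATIVE SLICE IS A THEOREM — (NPh_K) at the places over `2` for every habitat curve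
# MULTIPLICATIVE AT `2`, on every admissible Heegner frame with `2` split

Width seat `bsd-line-gk2-p5` g41 (cell `bsd-f1-sign2`), `--supports stmt-BirchSwinnertonDyer-31469 --as helper` (the K₄⁻ twin is the sign-free core
below read with `Δ < 0`; companion file `…K4NegOffCutNonPhantomAtTwoMult`).  THEOREMS ONLY (no definition, no named fact, no `sorry`).
**BSD is NOT proved by this file; `K4Pos` / `K4Neg` are NOT proved; nothing is closed.**

WHAT.  LINE 33/34 v1.3 (pen bsd-idea-1 g27) isolate, modulo the route's own items {WALL row 1, U₂, Q2, PRINT}, the ENTIRE beyond-print content of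
`K4Pos`/`K4Neg` in ONE stub F4″ `stub_offCutNonPhantomAtTwo`: on the off-cut K₄± cell (no ODD multiplicative prime) and an admissible frame `K` with `2`
split, every phantom class of `H¹(K, E[2^L])` (`L ≥ 1`) that is Kummer at the places of `K` over `2` is zero.  The off-cut cell still contains the curves
MULTIPLICATIVE AT `2` (`2 ∥ N`; LINE 26's instrument: 17 of the 58 residual cells below `5·10⁵`, witness at `2` on 17/17).  This file proves F4″ on
that slice, with F4″'s binders VERBATIM plus `(v₂ ∋ 2, W.HasMultiplicativeReductionAt v₂)`:
* `nonPhantomAtTwo_baseChange_of_hasMultiplicativeReductionAt_two` — sign-free core: `Odd (∏ c_p)`, `ρ̄_{2^n}` onto, `K` imaginary quadratic with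
  `d_K` odd, the two B₂ non-squares and `2` SPLIT, `v₂ ∋ 2` multiplicative ⟹ (NPh_K) at the places over `2`, all levels.  Proof: the Tate witness at
  `v₂` (`Lw2PhantomExclusion.levelTwoWitness_rat_of_hasMultiplicativeReductionAt_anyPlace`, this seat) ⟹ a `K`-witness at a place `w₀ ∣ v₂` of degree
  one (`2` split; gk2-p4 `levelTwoWitness_baseChange_of_finrank_eq_one`) ⟹ every phantom Kummer at `w₀` vanishes (gk2-p4 `eq_zero_pow_of_levelTwoWitness`,
  the downward induction of `stub_KLW`).
* `k4Pos_offCutNonPhantomAtTwo_of_hasMultiplicativeReductionAt_two` — F4″ of LINE 33 (K₄⁺) VERBATIM + the `2`-multiplicative hypothesis.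
So F4″ splits as («`2 ∥ N`»: THEOREM) ∧ («`2 ∤ N` or `4 ∣ N`»: the residual = integral `j`-invariant, every bad prime additive potentially good, where
odd primes are silent — `…NonPhantomAdditive` — and only the `2`-adic local question remains).

References: [LawsonWuthrich2016] §7.1, §8; [SilvermanATAEC1994] proof of Prop. V.6.1, Thm. V.5.3; [GrossLMS1991] §9 Prop. 9.1; [CasselsFrohlich1967]
Ch. I §10 Prop. 1 (degree `e·f`).
-/

set_option linter.dupNamespace false -- tree convention: `Summit.BirchSwinnertonDyer.BirchSwinnertonDyer.Theorems` (summit = sub-problem)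
set_option autoImplicit false

noncomputable section

open scoped Classical

namespace Summit.BirchSwinnertonDyer.BirchSwinnertonDyer.Theorems.GenusExact.Lw2PhantomExclusion

open WeierstrassCurve NumberField Field IsDedekindDomain
open Literature.NumberTheory.EllipticCurves Literature.NumberTheory.GaloisRepresentations

variable (W : WeierstrassCurve ℚ) [W.IsElliptic]

/-- ★ **(NPh_K) AT THE PLACES OVER `2` FOR A CURVE MULTIPLICATIVE AT `2` (sign-free core of F4″ on the `2`-multiplicative slice).**  `E/ℚ` with
`Odd (∏ c_p)` and `ρ̄_{E,2^n}` onto for all `n ≥ 1`; `K` imaginary quadratic with `d_K` odd, `d_K·(−|Δ|)`, `d_K·(−2|Δ|)` non-squares and `2` SPLIT in `K`;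
`v₂ ∋ 2` a place of MULTIPLICATIVE reduction.  Then for every `L ≥ 1`, every class of `H¹(K, E[2^L])` dying on `Γ_{K(E[2^L])}` that satisfies the
Kummer condition at every place of `K` over `2` is ZERO.  (Tate witness at `v₂` ⟹ `K`-witness at a degree-one `w₀ ∣ v₂` ⟹ KLW induction.)
[cite: LawsonWuthrich2016, §7.1 and §8] [cite: SilvermanATAEC1994, proof of Prop. V.6.1 (PDF p. 411)] [cite: CasselsFrohlich1967, Ch. I §10 Prop. 1] -/
theorem nonPhantomAtTwo_baseChange_of_hasMultiplicativeReductionAt_two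
    (hT : Odd W.tamagawaProduct) (hρ : ∀ n : ℕ, 0 < n → W.HasSurjectiveModNGaloisRep ((2 : ℤ) ^ n))
    (K : Type) [Field K] [NumberField K] (hIQ : IsImaginaryQuadratic K) (hodd : Odd (NumberField.discr K))
    (hsq1 : ¬ IsSquare ((NumberField.discr K : ℚ) * -|W.Δ|)) (hsq2 : ¬ IsSquare ((NumberField.discr K : ℚ) * (-(2 * |W.Δ|))))
    (h2K : ((Ideal.span {(2 : ℤ)}).primesOver (𝓞 K)).ncard = 2)
    {v₂ : HeightOneSpectrum (𝓞 ℚ)} (h2v : ((2 : ℕ) : 𝓞 ℚ) ∈ v₂.asIdeal) (hmult : W.HasMultiplicativeReductionAt v₂) :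
    ∀ (L : ℕ), 1 ≤ L → ∀ z : galH1Torsion (W.baseChange K) ((2 ^ L : ℕ) : ℤ),
      (∀ ρ' ∈ torsionFixing (W.baseChange K) ((2 ^ L : ℕ) : ℤ), h1Eval (W.baseChange K) ((2 ^ L : ℕ) : ℤ) z ρ' = 0) →
      (∀ w : HeightOneSpectrum (𝓞 K), ((2 : ℕ) : 𝓞 K) ∈ w.asIdeal →
        z ∈ selmerLocalKer (W.baseChange K) (w.adicCompletion K) ((2 ^ L : ℕ) : ℤ)) → z = 0 := by
  intro L hL z hz hw
  haveI : Fact (Nat.Prime 2) := ⟨Nat.prime_two⟩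
  have hwitQ := levelTwoWitness_rat_of_hasMultiplicativeReductionAt_anyPlace W hT hρ hmult
  obtain ⟨w₀, hw₀v, h2w₀⟩ := exists_place_liesOver_natCast_mem (K := K) two_ne_zero h2v
  haveI := hw₀v
  obtain ⟨he, hf⟩ := ramificationIdx_eq_one_and_inertiaDeg_eq_one_of_ncard_primesOver_eq_two 2 hIQ.1
    (by exact_mod_cast h2K) w₀ (by exact_mod_cast h2w₀)
  have hfin := finrank_adicCompletion_eq_one_of_ramificationIdx_eq_one (K := K) v₂ w₀ he hf
  have hwitK := levelTwoWitness_baseChange_of_finrank_eq_one W hρ hIQ hodd hsq1 hsq2 v₂ w₀ hfin hwitQ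
  exact eq_zero_pow_of_levelTwoWitness W hρ hIQ hodd hsq1 hsq2 hwitK hL le_rfl z hz (hw w₀ h2w₀)

/-- **LINE 33 stub F4″ `stub_offCutNonPhantomAtTwo` (K₄⁺) ON THE `2`-MULTIPLICATIVE SLICE — binders VERBATIM, plus `v₂ ∋ 2` multiplicative.**  The cell
hypotheses `¬CM`, `r_an = 0`, `Δ > 0`, the `#Sel₂` clause, «no odd multiplicative prime», `d_K ≠ −3`, Heegner are carried (unused): the content is the
sign-free core.  Reading for the pen: F4″ = (this theorem on `2 ∥ N`) ∧ (F4″ restricted to `2 ∤ N ∨ 4 ∣ N`, the integral-`j` residual).  BSD / `K4Pos` NOT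
proved. [cite: LawsonWuthrich2016, §7.1 and §8] [cite: SilvermanATAEC1994, proof of Prop. V.6.1 (PDF p. 411)] -/
theorem k4Pos_offCutNonPhantomAtTwo_of_hasMultiplicativeReductionAt_two
    (W : WeierstrassCurve ℚ) [W.IsElliptic] [W.IsGloballyMinimal] [NeZero (W.conductorNorm ℤ)]
    (_hcm : ¬ W.HasCM) (_hr0 : W.analyticRank = 0) (hρ : ∀ n : ℕ, 0 < n → W.HasSurjectiveModNGaloisRep ((2 : ℤ) ^ n))
    (hT : Odd W.tamagawaProduct) (_hpos : 0 < W.Δ)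
    (_h4 : Nat.card (W.selmerGroup 2) = 4 ∧ ∃ c ∈ (W.kummerSelmerStructure ((2 : ℕ) : ℤ)).selmerGroup,
      galoisCohomology.localization (W.torsionGaloisModule ((2 : ℕ) : ℤ)) (Sum.inl Rat.infinitePlace) 1 c ≠ 0)
    (_hoff : ¬ ∃ v : HeightOneSpectrum (𝓞 ℚ), ((2 : ℕ) : 𝓞 ℚ) ∉ v.asIdeal ∧ ((W.conductorNorm ℤ : ℕ) : 𝓞 ℚ) ∈ v.asIdeal ∧
      W.HasMultiplicativeReductionAt v)
    (K : Type) [Field K] [NumberField K] (hIQ : IsImaginaryQuadratic K) (hodd : Odd (NumberField.discr K))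
    (_h3 : NumberField.discr K ≠ -3) (_hHe : SatisfiesHeegnerHypothesis (W.conductorNorm ℤ) K)
    (hsq1 : ¬ IsSquare ((NumberField.discr K : ℚ) * -|W.Δ|)) (hsq2 : ¬ IsSquare ((NumberField.discr K : ℚ) * (-(2 * |W.Δ|))))
    (h2K : ((Ideal.span {(2 : ℤ)}).primesOver (𝓞 K)).ncard = 2)
    {v₂ : HeightOneSpectrum (𝓞 ℚ)} (h2v : ((2 : ℕ) : 𝓞 ℚ) ∈ v₂.asIdeal) (hmult : W.HasMultiplicativeReductionAt v₂) :
    ∀ (L : ℕ), 1 ≤ L → ∀ z : galH1Torsion (W.baseChange K) ((2 ^ L : ℕ) : ℤ),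
      (∀ ρ' ∈ torsionFixing (W.baseChange K) ((2 ^ L : ℕ) : ℤ), h1Eval (W.baseChange K) ((2 ^ L : ℕ) : ℤ) z ρ' = 0) →
      (∀ w : HeightOneSpectrum (𝓞 K), ((2 : ℕ) : 𝓞 K) ∈ w.asIdeal →
        z ∈ selmerLocalKer (W.baseChange K) (w.adicCompletion K) ((2 ^ L : ℕ) : ℤ)) → z = 0 :=
  nonPhantomAtTwo_baseChange_of_hasMultiplicativeReductionAt_two W hT hρ K hIQ hodd hsq1 hsq2 h2K h2v hmult

end Summit.BirchSwinnertonDyer.BirchSwinnertonDyer.Theorems.GenusExact.Lw2PhantomExclusion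

end
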